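import Summits.QuantumFields.BalabanUV.Beta.SecondOrderBorderNoModel
import Summits.QuantumFields.BalabanUV.Beta.KernelWardLevels
import Summits.QuantumFields.BalabanUV.Beta.SpineRecursiveInductive

/-!
# `BalabanUV.Beta.SecondOrderBorderNoModelWitness` — binder row D1, (L4): **THE COUNTING WITNESS AND THE CLOSED NO-MODEL STATEMENT FOR THE
# `Lc = 3` WALL** (X-an2-46 / referee I-d1ref11-1, closed in the kernel): at `d + 1 = 4`, `Lc = 3`, centred root, the first-order border
# table has a non-zero field–multiplier entry with field direction `2`, multiplier direction `0` and background direction `1` (all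
# distinct): `vhSAt ρ_c 1 r r 0 (inl 2) (inr 0) ≠ 0` at the root bond base `r = (1,1,1,1)` (by `decide` on an1's integer counts:
# `hessCountAt = 0`, `vhCountAt = −linCountAt (2,r) · linCountAt (1,r) ≠ 0`); hence, by `SecondOrderBorderNoModel.no_twin_border_model`,
# **the border socket (hBfm ∧ hBmf with a parity-odd residual) of `SpineRooted.…_JsRecWAtOf_of_letters_final` has NO model at ANY twin
# (`packVH`-type, parity-odd) border table `vh₂S` — in particular at an1's `vh₂SAt` — for the `Lc = 3` wall** (β sub-cell, row BETA-an2 =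
# BINDER-OWNERS row D1 OWNER, lineage an2 gen 19)

HONEST FRAMING (cell charter, verbatim): «discharging BetaPertH makes Balaban's UV stability UNCONDITIONAL — a real
constructive-QFT result; it is NOT the continuum limit and NOT the Clay problem.»  Neutral kernel algebra and integer counting ([folklore]);
no statement of Bałaban's papers, no `[cite:]`, no `def`, no `Prop` fact; instantiates no binder of the wall.  It REFUTES nothing that is
landed: `vh₂S` is a free binder of every END; the theorem says which instantiations are vacuous (the twin ones) — the wall's second-order
border table must be packed ANTI-twin (`SpineRecursiveT2AllAntiTwin`).  NOT D1, NOT `BetaPertH`, NOT continuum, NOT Clay.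
Provenance: β sub-cell, unit beta-an2 gen 19, 2026-08-20 (v1); no existing file touched.
-/

open Finset
open scoped BigOperators
open Literature.MathematicalPhysics.QuantumFieldTheory
open Literature.MathematicalPhysics.QuantumFieldTheory.Balaban1983to89
open Literature.MathematicalPhysics.QuantumFieldTheory.Balaban1983to89.Beta
open ExpKernelCalculus (MKer)
open AffineAveraging (box toSite)
open AveragingContours (blk off)
open AveragingContoursRooted (ctr ctrOff ctrOff_mem_box)
open AveragingHessianKernels (packVH_inl_inr)
open AveragingHessianKernelsRooted (vhSAt vhKerAt vhCountAt hessCountAt linCountAt)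
open PolarizationSign (reflSign)
open KernelReflection (refK)
open ResolventReflection (bref Φ)
open OneStepResolventKernel (Fib)
open BalabanStepJetsSucc (wVH)
open BalabanStepW2 (wB2)
open Summit.QuantumFields.BalabanUV.Beta.TameKernelCalculus
open Summit.QuantumFields.BalabanUV.Beta.ChartConjugation (conjW)
open Summit.QuantumFields.BalabanUV.Beta.BorderedHessian (sgnK diagK ctGen bhKStepAt stepScale)
open Summit.QuantumFields.BalabanUV.Beta.KernelWardLevels (stepScale_zero)
open Summit.QuantumFields.BalabanUV.Beta.WilsonReflectionContact (wilsonA_inl_inr)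
open Summit.QuantumFields.BalabanUV.Beta.SecondOrderBorderNoModel (no_twin_border_model)
open Summit.QuantumFields.BalabanUV.Beta.SpineRooted (SpureRecAt SpureRecAt_zero_level wVH_zero)

namespace Summit.QuantumFields.BalabanUV.Beta.SecondOrderBorderNoModelWitness

noncomputable section

/-! ## §1 The integer counts at the root bonds (d + 1 = 4, L = 3, centred root, block `y = 0`, average direction `0`) -/

/-- [folklore] No contour word of the `0`-average of the block at the origin contains BOTH root bonds `(2, r)` and `(1, r)`: the pair count
vanishes (`decide`). -/
theorem hessCountAt_root_pair : hessCountAt (toSite (ctrOff 4 3)) 3 (0 : Fin 4) (0 : Fin 4 → ℤ) ((2 : Fin 4), ![1, 1, 1, 1]) ((1 : Fin 4), ![1, 1, 1, 1]) = 0 := by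
  set_option maxRecDepth 200000 in decide

/-- [folklore] **THE COUNTING WITNESS**: the product-chart mixed count at the two root bonds is non-zero (`= −linCountAt (2,r) · linCountAt (1,r)`;
`decide`). -/
theorem vhCountAt_root_pair_ne_zero :
    vhCountAt (toSite (ctrOff 4 3)) 3 (0 : Fin 4) (0 : Fin 4 → ℤ) ((2 : Fin 4), ![1, 1, 1, 1]) ((1 : Fin 4), ![1, 1, 1, 1]) ≠ 0 := by
  set_option maxRecDepth 200000 in decide

/-- [folklore] The first-order border table entry: `vhSAt ρ_c 3 Lc 1 r r 0 (inl 2) (inr 0) ≠ 0` (`Lc = 3`, `r = (1,1,1,1)`). -/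
theorem vhSAt_root_pair_ne_zero :
    vhSAt (toSite (ctrOff 4 3)) 3 3 rfl (1 : Fin 4) ![1, 1, 1, 1] ![1, 1, 1, 1] (0 : Fin 4 → ℤ) (Sum.inl (2 : Fin 4)) (Sum.inr (0 : Fin 4)) ≠ 0 := by
  have hoff : off 3 (0 : Fin 4 → ℤ) = 0 := by funext i; simp [AveragingContours.off]
  have hblk : blk 3 (0 : Fin 4 → ℤ) = 0 := by funext i; simp [AveragingContours.blk]
  rw [AveragingHessianKernelsRooted.vhSAt, packVH_inl_inr, if_pos hoff, hblk, AveragingHessianKernelsRooted.vhKerAt]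
  have h := vhCountAt_root_pair_ne_zero
  have h3 : (2 * (3 : ℝ) ^ (2 * 4)) ≠ 0 := by norm_num
  intro h0
  rw [div_eq_zero_iff] at h0
  rcases h0 with h0 | h0
  · exact h (by exact_mod_cast h0)
  · exact h3 h0

/-- [folklore] The level-`0` unfolded first-order table of the `Lc = 3` wall at the background bond `(1, r)`: its field–multiplier entry
`(r, inl 2; 0, inr 0)` is `cVH · vhSAt … ≠ 0` (`cVH = −3⁸/2`; the Wilson piece has no border block). -/
theorem SpureRecAt_zero_root_pair_ne_zero (cΛ : ℝ) :
    SpureRecAt 3 3 (toSite (ctrOff 4 3)) ((3 : ℝ) ^ 4) (-((3 : ℝ) ^ 8 / 2)) cΛ 0 (1 : Fin 4) ![1, 1, 1, 1] ![1, 1, 1, 1] (0 : Fin 4 → ℤ)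
      (Sum.inl (2 : Fin 4)) (Sum.inr (0 : Fin 4)) ≠ 0 := by
  rw [SpureRecAt_zero_level]
  simp only [Pi.add_apply, Pi.smul_apply, smul_eq_mul, wilsonA_inl_inr, mul_zero, zero_add]
  exact mul_ne_zero (by norm_num) vhSAt_root_pair_ne_zero

/-! ## §2 The closed statement: no twin model of the border socket for the `Lc = 3` wall -/

/-- [folklore] **NO TWIN MODEL OF THE END's BORDER SOCKET, `Lc = 3` WALL**: for every coefficient `cΛ`, `cB`, the wall's `γ` (`γ_j =
−(Lc⁸/2)·wVH j/(stepScale j·Lc⁴)`), EVERY twin border table `vh₂S` (e.g. `vh₂SAt`, `packVH_symm`) and every family `RB` with parity-odd rows,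
the two border blocks (hBfm)/(hBmf) of `SpineRooted.axisReflectionCovariant_flipK_TbalOf_JsRecWAtOf_of_letters_final` (stated for all levels
`j` and axes `α`) cannot both hold — they already fail at `j = 0`, `α = 2`. -/
theorem final_border_socket_no_twin_model_Lc3 (cΛ cB : ℝ) (γ : ℕ → ℝ)
    (hγ : ∀ j, γ j = -((3 : ℝ) ^ 8 / 2) * wVH 3 3 j / (stepScale 3 3 j * (3 : ℝ) ^ 4))
    {vh₂S : Fin 4 → (Fin 4 → ℤ) → Fin 4 → (Fin 4 → ℤ) → MKer 4 (Fib 3)}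
    (hBtw : ∀ κ u κ' u' (x z : Fin 4 → ℤ) (β m : Fin 4), vh₂S κ u κ' u' z x (Sum.inr m) (Sum.inl β) = vh₂S κ u κ' u' x z (Sum.inl β) (Sum.inr m))
    (RB : ℕ → Fin 4 → Fin 4 → (Fin 4 → ℤ) → Fin 4 → (Fin 4 → ℤ) → MKer 4 (Fib 3))
    (hRBp : ∀ (j : ℕ) (α : Fin 4) κ u κ' u', trK (RB j α κ u κ' u') = -sgnK (RB j α κ u κ' u'))
    (hBfm : ∀ (j : ℕ) (α : Fin 4) κ u κ' u' (x z : Fin 4 → ℤ) (β m : Fin 4),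
      ((cB * wB2 3 3 j) • vh₂S κ (bref α κ u) κ' (bref α κ' u')) x z (Sum.inl β) (Sum.inr m) =
        ((reflSign α κ * reflSign α κ') • refK (Φ 3 α) ((cB * wB2 3 3 j) • vh₂S κ u κ' u' +
          conjW (bhKStepAt 3 (toSite (ctrOff 4 3)) 3 j)
            (SpureRecAt 3 3 (toSite (ctrOff 4 3)) ((3 : ℝ) ^ 4) (-((3 : ℝ) ^ 8 / 2)) cΛ j κ u)
            (SpureRecAt 3 3 (toSite (ctrOff 4 3)) ((3 : ℝ) ^ 4) (-((3 : ℝ) ^ 8 / 2)) cΛ j κ' u')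
            (diagK fun p c => γ j * ctGen 3 α 3 κ u p c) (diagK fun p c => γ j * ctGen 3 α 3 κ' u' p c)
            (diagK fun p c => γ j ^ 2 * (ctGen 3 α 3 κ u p c * ctGen 3 α 3 κ' u' p c)) + RB j α κ u κ' u')) x z (Sum.inl β) (Sum.inr m))
    (hBmf : ∀ (j : ℕ) (α : Fin 4) κ u κ' u' (x z : Fin 4 → ℤ) (m β : Fin 4),
      ((cB * wB2 3 3 j) • vh₂S κ (bref α κ u) κ' (bref α κ' u')) x z (Sum.inr m) (Sum.inl β) =
        ((reflSign α κ * reflSign α κ') • refK (Φ 3 α) ((cB * wB2 3 3 j) • vh₂S κ u κ' u' +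
          conjW (bhKStepAt 3 (toSite (ctrOff 4 3)) 3 j)
            (SpureRecAt 3 3 (toSite (ctrOff 4 3)) ((3 : ℝ) ^ 4) (-((3 : ℝ) ^ 8 / 2)) cΛ j κ u)
            (SpureRecAt 3 3 (toSite (ctrOff 4 3)) ((3 : ℝ) ^ 4) (-((3 : ℝ) ^ 8 / 2)) cΛ j κ' u')
            (diagK fun p c => γ j * ctGen 3 α 3 κ u p c) (diagK fun p c => γ j * ctGen 3 α 3 κ' u' p c)
            (diagK fun p c => γ j ^ 2 * (ctGen 3 α 3 κ u p c * ctGen 3 α 3 κ' u' p c)) + RB j α κ u κ' u')) x z (Sum.inr m) (Sum.inl β)) :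
    False := by
  have hγ0 : γ 0 ≠ 0 := by
    rw [hγ 0, wVH_zero, stepScale_zero]; norm_num
  have h12 : (1 : Fin 4) ≠ 2 := by decide
  have h02 : (0 : Fin 4) ≠ 2 := by decide
  exact no_twin_border_model (d := 3) (Lc := 3) ((3 : ℝ) ^ 4) (-((3 : ℝ) ^ 8 / 2)) cΛ γ (cB * wB2 3 3 0) (by norm_num) (ctrOff_mem_box (by norm_num)) 0
    (2 : Fin 4) hγ0 hBtw (u := ![1, 1, 1, 1]) h12 (u' := ![1, 1, 1, 1]) (z := 0) h02 (SpureRecAt_zero_root_pair_ne_zero cΛ)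
    ⟨RB 0 2, hRBp 0 2, hBfm 0 2, hBmf 0 2⟩

end

end Summit.QuantumFields.BalabanUV.Beta.SecondOrderBorderNoModelWitness
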